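import Summits.QuantumFields.YangMills.Theorems.FluctuationComparisonRegPrIntLS1aCutTowerGaugeInvariant
import Summits.QuantumFields.YangMills.Theorems.FluctuationComparisonRegPrIntLS1aPhiMOfDominatedBG
import HarnessLib

/-!
# S1a · THE ᴱ-EDITION OF THE (m)-DOOR OF RECORD FOR THE LINE's TOWER (✓p828515 ∕ ✓p830144 → v19 «BACKGROUND WINDOWS»): the (α)-package + the five
# letters at `(K, K−j)` + the NEW cut-height letter `hdomBG_j` ⟹ the letter `Φ_m` OF THE CUT DENSITY at every height of every invariantly cut tower

Cell `ym3-torus` (YM ladder rung R3 = continuum `SU(2)` Yang–Mills on the three-torus — a RUNG: NOT d = 4, NOT infinite volume, NOT a mass gap, NOT Clay).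
Width seat «width 8» `ym3-torus-px8` (gen 25), FREE px helper on crux `stmt-QuantumFields-20520`, count-neutral, DEFINITION-FREE, default heartbeats.

WHY.  ✓p828515∕✓p830144 (this lineage ∕ px20) deliver the OLD (m) letter `∃ κ, MemOfRun … (e^κ·ρᶜ)` for the cut tower from the letter `hdom_j` («`ρᵗ ≤ e^{Δ_j}ρᶜ`
on the whole datum window»), which UV3-NODE §69.17 shows UNSATISFIABLE for the (½, 24∕25) cut at `L = 3`.  Under repair (E) (LEAD w3 RULING №60∕№61, ★★OWNER
RULING №105; [Balaban1985UV3] (47) p.267: `χ_k` windows the BACKGROUND), the (m) conjunct is the def-free letter `Φ_m` (v1.2 text; tree: ✓`…ELetterExtraction`),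
and the cut-height step needs domination only at data with a fine-small regular minimiser — the letter `hdomBG_j` of ✓`…S1aPhiMOfDominatedBG` (p831092).  This file
composes: ✓`…S1aAlphaMemOfRunOfAlpha.exists_admissible_schedule_memOfRun` (the (m)-door for the RUN density at every `(K, j)`) → ✓`…ELetterExtraction.phiM_of_memOfRun`
→ ✓`…S1aPhiMOfDominatedBG.phiM_of_dominated_bg` (with ✓`…S1aMemOfDominated.cutTower_le_run` ∕ `density_le_of_withDensity_le` ∕ `gaugeInvariant_of_continuous_of_ae` ∕
`admissible_add_slack` and ✓`…S1aCutTowerGaugeInvariant.cutTower_density_ae_gaugeInvariant` for the cut density's side conditions).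

WHAT.  ★★★ `exists_admissible_schedule_phiM_tower_bg` — under `AlphaInputsT3ACFullTriv …` + numerics + a budget `0 ≤ Δ_j ≤ S₁q₁^j`: ONE schedule `prm`,
`AdmissibleClassParams F γ (b₀∕2) p₀ prm` (fields displayed), such that for EVERY run system, every `K`, `Ts ≤ K`, every tower cut below `Ts` by gauge-invariant
weights `χ ≤ 1`, every height `j ≤ K`, continuous `ρᶜ ≥ 0` (density of `μ j`) and `ρᵗ ≥ 0` (density of `ν K j`): [four binders + LF clause at `(K, K−j)`] +
[`hdomBG_j`] ⟹ `Φ_m(K, hjK, {prm j with β := β_K}, ρᶜ)` — the v1.2 letter TEXT with the schedule entry `{prm j with β := β_K}` (the (R-β1′) slot displayed exactly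
as in ✓p828515).  Sorry-free, axioms standard.

HONEST: a composition of landed doors; the (α)-inhabitant, `hlowc`∕`hupc`∕`hRegClass`∕`hlfle`∕`hlarge`, `hdomBG_j` and the (R-β1′) β slot remain DISPLAYED and
UNDISCHARGED; nothing of Bałaban's renormalisation-group analysis is asserted or proved; (m) AS TYPED suspect-false at `L = 3` (§69.17), (m)_E OPEN; the five
registered stubs (3732b7df) ∕ 20520 ∕ 19936 ∕ 19200 ∕ `YM3TorusSU2` NOT proved; rung R3 = SU(2) YM₃ on T³ — NOT d = 4, NOT infinite volume, NOT a mass gap, NOT Clay.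
-/

set_option autoImplicit false

noncomputable section

namespace Summit.QuantumFields.YangMills.Theorems.FluctuationComparisonRegPrIntLS1aAlphaPhiMTowerBG

open MeasureTheory Set
open Literature.MathematicalPhysics.QuantumFieldTheory.Balaban1983to89
open T3ContinuumYM3Torus T3UnitScaleTilt T3UnitLawDensityEML T3RestrictedUnitDensity T3AlphaInputsAC T3AlphaInputsACSchemas T3AlphaInputsACTrivRows BalabanUVClass
open T3NestedUnitLaws (descend)
open B5Eq118OneStroke (iterBlockOf)
open Literature.MathematicalPhysics.QuantumFieldTheory.Balaban1983to89.Missing (partitionFn)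
open Summit.QuantumFields.YangMills.Theorems.FluctuationComparisonRegPrIntLS1aAlphaMemOfRunOfAlpha (exists_admissible_schedule_memOfRun)
open Summit.QuantumFields.YangMills.Theorems.FluctuationComparisonRegPrIntLS1aMemOfDominated
  (gaugeInvariant_of_continuous_of_ae density_le_of_withDensity_le cutTower_le_run admissible_add_slack)
open Summit.QuantumFields.YangMills.Theorems.FluctuationComparisonRegPrIntLS1aCutTowerGaugeInvariant (cutTower_density_ae_gaugeInvariant)
open Summit.QuantumFields.YangMills.Theorems.FluctuationComparisonRegPrIntLELetterExtraction (phiM_of_memOfRun)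
open Summit.QuantumFields.YangMills.Theorems.FluctuationComparisonRegPrIntLS1aPhiMOfDominatedBG (phiM_of_dominated_bg)

variable {F : T3Family} {γ : ℝ}

/-- ★★★ **THE ᴱ-EDITION OF THE (m)-DOOR OF RECORD FOR THE TOWER.**  See the module docstring: ONE admissible schedule; at every height of every invariantly cut
tower the four binders + LF clause at `(K, K−j)` and the background-windowed domination letter `hdomBG_j` give the v1.2 letter `Φ_m` for the CUT density, schedule
entry `{prm j with β := β_K}`. [cite: Balaban1985UV3, (41)-(47) pp.266-267, (2) p.256, (6) p.257] -/
theorem exists_admissible_schedule_phiM_tower_bg {D : AlphaDataT3 F γ} (W : LFData D) {b₀ p₀ ε₀ C68 Cχ B₃ r CD R₀ C₅ : ℝ} {M₁ : ℕ}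
    (h : AlphaInputsT3ACFullTriv D W b₀ p₀ ε₀ C68 Cχ B₃ M₁ r CD) (hγ : 0 < γ) (hγ1 : γ ≤ 1) (hγe : Real.sqrt γ ≤ Real.exp (1 - p₀)) (hb : 0 ≤ b₀) (hp : 0 ≤ p₀)
    (hr : 0 ≤ r) (hM1 : 1 ≤ M₁) (hMdvd : M₁ ∣ 2 * F.L ^ F.m) (hCD : 0 ≤ CD) (hR₀ : 0 < R₀)
    (Δ : ℕ → ℝ) {S₁ q₁ : ℝ} (hq₁0 : 0 ≤ q₁) (hq₁1 : q₁ < 1) (hΔ0 : ∀ j, 0 ≤ Δ j) (hΔ : ∀ j, Δ j ≤ S₁ * q₁ ^ j) :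
    ∃ prm : ℕ → ClassParams, AdmissibleClassParams F γ (b₀ / 2) p₀ prm ∧
      (∀ n, (prm n).δ = θBal F.L γ b₀ p₀ n ∧ (prm n).δreg = R₀ ∧ (prm n).δL = θBal F.L γ b₀ p₀ n ∧ (prm n).β = (F.L : ℝ) ^ n / γ ∧
        (prm n).cLF = B10.pFun (b₀ / 2) p₀ (Real.sqrt (γ * ((F.L : ℝ)⁻¹) ^ n)) ^ 2 / 4 ∧ (prm n).c5 = C₅ ∧ (prm n).cE = 0) ∧
      ∀ (ν : ℕ → (j : ℕ) → Measure (GaugeField (F.P j) 0 (Matrix.specialUnitaryGroup (Fin 2) ℂ))),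
        (∀ K, ν K K = T4GenFunBounds.gibbsMeasure (F.P K) ((F.scheme ℰp γ).β K)) →
        (∀ K j, j < K → ν K j = Measure.map (descend F ℰp j) (ν K (j + 1))) →
        ∀ (K Ts : ℕ), Ts ≤ K → ∀ (μ : (j : ℕ) → Measure (GaugeField (F.P j) 0 (Matrix.specialUnitaryGroup (Fin 2) ℂ)))
          (χ : (j : ℕ) → GaugeField (F.P j) 0 (Matrix.specialUnitaryGroup (Fin 2) ℂ) → ℝ), (∀ j U, χ j U ≤ 1) →
          (∀ (j : ℕ) (u : GaugeTransf (F.P j) 0 (Matrix.specialUnitaryGroup (Fin 2) ℂ)) (U : GaugeField (F.P j) 0 (Matrix.specialUnitaryGroup (Fin 2) ℂ)),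
            χ j (GaugeField.gaugeAct u U) = χ j U) →
          (∀ j, Ts ≤ j → μ j = ν K j) →
          (∀ j, j < Ts → μ j = Measure.map (descend F ℰp j) ((μ (j + 1)).withDensity fun U => ENNReal.ofReal (χ (j + 1) U))) →
        ∀ (j : ℕ) (hjK : j ≤ K) (ρc ρt : GaugeField (F.P j) 0 (Matrix.specialUnitaryGroup (Fin 2) ℂ) → ℝ),
          Continuous ρc → Continuous ρt → (∀ V, 0 ≤ ρc V) → (∀ V, 0 ≤ ρt V) →
          μ j = (fieldMeasure (F.P j) 0 (Matrix.specialUnitaryGroup (Fin 2) ℂ)).withDensity (fun V => ENNReal.ofReal (ρc V)) →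
          ν K j = (fieldMeasure (F.P j) 0 (Matrix.specialUnitaryGroup (Fin 2) ℂ)).withDensity (fun V => ENNReal.ofReal (ρt V)) →
          ContinuousOn (D.low K (K - j)) {V | PlaqSmall (θBal F.L γ b₀ p₀ j) V} →
          ContinuousOn (D.up K (K - j)) {V | PlaqSmall (θBal F.L γ b₀ p₀ j) V} →
          (∀ V : GaugeField (F.P K) (K - j) (Matrix.specialUnitaryGroup (Fin 2) ℂ), PlaqSmall (θBal F.L γ b₀ p₀ j) V →
            IsBackground (fun i => BlockAveraging.blockAvg (P := F.P K) (j := i) ℰp) {U | PlaqSmall R₀ U} (K - j) V (D.Umin K (K - j) (D.triv K (K - j)) V)) →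
          (∀ V : GaugeField (F.P K) (K - j) (Matrix.specialUnitaryGroup (Fin 2) ℂ),
            Real.exp (D.Ecst K (K - j)) * (Real.exp (-(D.Ecst K (K - j)) + D.Rm K (K - j)) * (D.up K (K - j) V - D.low K (K - j) V)) ≤
              Real.exp (-(prm j).cLF) * Real.exp (C₅ * Fintype.card (Site (F.P K) (K - j)))) →
          (∀ (V : GaugeField (F.P K) (K - j) (Matrix.specialUnitaryGroup (Fin 2) ℂ)) (S : Finset (Plaq (F.P K) (K - j))),
            (∀ p ∈ S, θBal F.L γ b₀ p₀ j ≤ GaugeGroup.dist1 (GaugeField.plaqHol V p)) →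
              Real.exp (D.Ecst K (K - j)) * (partitionFn (G := (Matrix.specialUnitaryGroup (Fin 2) ℂ)) (F.P K) ((F.scheme ℰp γ).β K) * readAtLevel F hjK ρt V) ≤
                Real.exp (-((prm j).cLF * S.card)) * Real.exp (C₅ * Fintype.card (Site (F.P K) (K - j)))) →
          (∀ V : GaugeField (F.P K) (K - j) (Matrix.specialUnitaryGroup (Fin 2) ℂ), PlaqSmall (θBal F.L γ b₀ p₀ j) V →
            (∃ U₀ : GaugeField (F.P K) 0 (Matrix.specialUnitaryGroup (Fin 2) ℂ),
                IsBackground (fun i => BlockAveraging.blockAvg (P := F.P K) (j := i) ℰp) {U | PlaqSmall R₀ U} (K - j) V U₀ ∧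
                PlaqSmall (θBal F.L γ b₀ p₀ j * ((F.L : ℝ)⁻¹) ^ (2 * (K - j))) U₀) →
            readAtLevel F hjK ρt V ≤ Real.exp (Δ j) * readAtLevel F hjK ρc V) →
          ∃ κ : ℝ, ∃ (bg : GaugeField (F.P K) (K - j) (Matrix.specialUnitaryGroup (Fin 2) ℂ) → GaugeField (F.P K) 0 (Matrix.specialUnitaryGroup (Fin 2) ℂ))
            (nDom : ℕ) (supp : Fin nDom → Set (PBond (F.P K) 0)) (foot : Fin nDom → Finset (Site (F.P K) (K - j)))
            (len : Fin nDom → ℝ) (wt : Fin nDom → ℝ) (act : Fin nDom → GaugeField (F.P K) 0 (Matrix.specialUnitaryGroup (Fin 2) ℂ) → ℝ)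
            (cst : ℝ) (lf : GaugeField (F.P K) (K - j) (Matrix.specialUnitaryGroup (Fin 2) ℂ) → ℝ),
            (∀ V, 0 ≤ readAtLevel F hjK (fun U => Real.exp κ * ρc U) V) ∧
            Measurable (readAtLevel F hjK (fun U => Real.exp κ * ρc U)) ∧
            GaugeField.GaugeInvariant (readAtLevel F hjK (fun U => Real.exp κ * ρc U)) ∧
            (∀ V, PlaqSmall ({ prm j with β := (F.scheme ℰp γ).β K }).δ V →
              IsBackground (fun i => BlockAveraging.blockAvg (P := F.P K) (j := i) ℰp) {U | PlaqSmall ({ prm j with β := (F.scheme ℰp γ).β K }).δreg U} (K - j) V (bg V)) ∧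
            (∀ X, (foot X).Nonempty) ∧ (∀ X b, b ∈ supp X → iterBlockOf (K - j) b.src ∈ foot X) ∧ (∀ X, 0 ≤ len X) ∧ (∀ X, 0 ≤ wt X) ∧
            (∀ X, ∀ y ∈ foot X, ∀ y' ∈ foot X, (Site.tdist y y' : ℝ) ≤ ({ prm j with β := (F.scheme ℰp γ).β K }).M * (len X + 1)) ∧
            (∀ X (U U' : GaugeField (F.P K) 0 (Matrix.specialUnitaryGroup (Fin 2) ℂ)), (∀ b ∈ supp X, U b = U' b) → act X U = act X U') ∧
            (∀ X, GaugeField.GaugeInvariant (act X)) ∧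
            (∀ X V, PlaqSmall ({ prm j with β := (F.scheme ℰp γ).β K }).δ V → PlaqSmall (({ prm j with β := (F.scheme ℰp γ).β K }).δ * ((F.L : ℝ)⁻¹) ^ (2 * (K - j))) (bg V) →
              |act X (bg V)| ≤ wt X * Real.exp (-(({ prm j with β := (F.scheme ℰp γ).β K }).κ * len X))) ∧
            (∀ y : Site (F.P K) (K - j), ∑ X ∈ Finset.univ.filter (fun X => y ∈ foot X), wt X * Real.exp (-(({ prm j with β := (F.scheme ℰp γ).β K }).κ * len X)) ≤ ({ prm j with β := (F.scheme ℰp γ).β K }).Ccov) ∧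
            |cst| ≤ ({ prm j with β := (F.scheme ℰp γ).β K }).cE * Fintype.card (Site (F.P K) (K - j)) ∧
            (∀ V, PlaqSmall ({ prm j with β := (F.scheme ℰp γ).β K }).δ V → PlaqSmall (({ prm j with β := (F.scheme ℰp γ).β K }).δ * ((F.L : ℝ)⁻¹) ^ (2 * (K - j))) (bg V) →
              Real.exp (-(({ prm j with β := (F.scheme ℰp γ).β K }).β * wilsonAction4 (bg V)) + (∑ X, act X (bg V)) + cst - ({ prm j with β := (F.scheme ℰp γ).β K }).slack) ≤ readAtLevel F hjK (fun U => Real.exp κ * ρc U) V) ∧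
            (∀ V, PlaqSmall ({ prm j with β := (F.scheme ℰp γ).β K }).δ V → PlaqSmall (({ prm j with β := (F.scheme ℰp γ).β K }).δ * ((F.L : ℝ)⁻¹) ^ (2 * (K - j))) (bg V) →
              readAtLevel F hjK (fun U => Real.exp κ * ρc U) V ≤ Real.exp (-(({ prm j with β := (F.scheme ℰp γ).β K }).β * wilsonAction4 (bg V)) + (∑ X, act X (bg V)) + cst + ({ prm j with β := (F.scheme ℰp γ).β K }).slack) + lf V) ∧
            (∀ V, 0 ≤ lf V) ∧ (∀ V, lf V ≤ Real.exp (-({ prm j with β := (F.scheme ℰp γ).β K }).cLF) * Real.exp (({ prm j with β := (F.scheme ℰp γ).β K }).c5 * Fintype.card (Site (F.P K) (K - j)))) ∧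
            (∀ V (S : Finset (Plaq (F.P K) (K - j))), (∀ p ∈ S, ({ prm j with β := (F.scheme ℰp γ).β K }).δL ≤ dist1 (GaugeField.plaqHol V p)) →
              readAtLevel F hjK (fun U => Real.exp κ * ρc U) V ≤ Real.exp (-(({ prm j with β := (F.scheme ℰp γ).β K }).cLF * S.card)) * Real.exp (({ prm j with β := (F.scheme ℰp γ).β K }).c5 * Fintype.card (Site (F.P K) (K - j)))) := by
  obtain ⟨prm₀, hadm₀, hfields, hmem⟩ := exists_admissible_schedule_memOfRun (F := F) W h hγ hγ1 hγe hb hp hr hM1 hMdvd hCD hR₀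
  refine ⟨fun n => { prm₀ n with slack := (prm₀ n).slack + Δ n }, admissible_add_slack F hadm₀ Δ hq₁0 hq₁1 hΔ,
    fun n => ⟨(hfields n).1, (hfields n).2.1, (hfields n).2.2.1, (hfields n).2.2.2.1, (hfields n).2.2.2.2.1, (hfields n).2.2.2.2.2.1,
      (hfields n).2.2.2.2.2.2⟩, ?_⟩
  intro ν hν1 hν2 K Ts hTs μ χ hχ1 hχinv hμ1 hμ2 j hjK ρc ρt hcc htc hc0 ht0 hμc hνt hlowc hupc hRegClass hlfle hlarge hdomBG
  -- (m) for the RUN density at this height, as the OLD letter, at the schedule entry `{prm₀ j with β := β_K}`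
  obtain ⟨κ, hm⟩ := hmem ν hν1 hν2 K j hjK ρt htc ht0 hνt hlowc hupc hRegClass hlfle hlarge
  -- project it to the NEW letter Φ_m
  have hΦt := phiM_of_memOfRun F hjK (fun n => { prm₀ n with β := (F.scheme ℰp γ).β K }) ρt ⟨κ, hm⟩
  -- side conditions of the cut density
  have hle : μ j ≤ ν K j := cutTower_le_run F ν hν2 hTs μ χ hχ1 hμ1 hμ2 j hjK
  rw [hμc, hνt] at hle
  have hptw : ∀ V, ρc V ≤ ρt V := density_le_of_withDensity_le hcc htc ht0 hle
  have hinv : GaugeField.GaugeInvariant ρc :=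
    gaugeInvariant_of_continuous_of_ae hcc (cutTower_density_ae_gaugeInvariant F hγ.le ν hν1 hν2 hTs μ χ hχinv hμ1 hμ2 hjK hcc hc0 hμc)
  -- the background-windowed domination letter, re-keyed to the schedule's fields
  have hdom' : ∀ V : GaugeField (F.P K) (K - j) (Matrix.specialUnitaryGroup (Fin 2) ℂ),
      PlaqSmall ((fun n => ({ prm₀ n with β := (F.scheme ℰp γ).β K } : ClassParams)) j).δ V →
      (∃ U₀ : GaugeField (F.P K) 0 (Matrix.specialUnitaryGroup (Fin 2) ℂ),
          IsBackground (fun i => BlockAveraging.blockAvg (P := F.P K) (j := i) ℰp)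
            {U | PlaqSmall ((fun n => ({ prm₀ n with β := (F.scheme ℰp γ).β K } : ClassParams)) j).δreg U} (K - j) V U₀ ∧
          PlaqSmall (((fun n => ({ prm₀ n with β := (F.scheme ℰp γ).β K } : ClassParams)) j).δ * ((F.L : ℝ)⁻¹) ^ (2 * (K - j))) U₀) →
      readAtLevel F hjK ρt V ≤ Real.exp (Δ j) * readAtLevel F hjK ρc V := by
    intro V hV hex
    have hV' : PlaqSmall (prm₀ j).δ V := hV
    rw [(hfields j).1] at hV'
    obtain ⟨U₀, h1, h2⟩ := hex
    have h1' : IsBackground (fun i => BlockAveraging.blockAvg (P := F.P K) (j := i) ℰp) {U | PlaqSmall (prm₀ j).δreg U} (K - j) V U₀ := h1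
    have h2' : PlaqSmall ((prm₀ j).δ * ((F.L : ℝ)⁻¹) ^ (2 * (K - j))) U₀ := h2
    rw [(hfields j).2.1] at h1'
    rw [(hfields j).1] at h2'
    exact hdomBG V hV' ⟨U₀, h1', h2'⟩
  haveI : BorelSpace (GaugeField (F.P j) 0 (Matrix.specialUnitaryGroup (Fin 2) ℂ)) := T3OrbitAverage.instBorelSpaceGaugeField
  exact phiM_of_dominated_bg F hjK (fun n => { prm₀ n with β := (F.scheme ℰp γ).β K }) ρt ρc (hΔ0 j) hΦt hcc.measurable hinv hc0 hptw hdom'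

end Summit.QuantumFields.YangMills.Theorems.FluctuationComparisonRegPrIntLS1aAlphaPhiMTowerBG

end
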